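import Summits.QuantumFields.YangMills.Theorems.BalabanUVNodesN15BackgroundV1GaugeByName
import Summits.QuantumFields.YangMills.Theorems.BalabanUVNodesN15VectorPieceV1
import Summits.QuantumFields.YangMills.Theorems.BalabanUVNodesN15KingTorusLine
import HarnessLib

/-!
# Route «BalabanUVNodes» (K4 «SpineRates»), node N15 = NE2 — THE GAUGE-DATUM KNIT: King's bond pairing has STEP-CONNECTED fibres (two monotone walks from the
# block corner), hence `T4EtaRate.NE2PlusOperator` BY NAME for the U = 1 vector piece ⊗ 1_𝔤 dressed by the print's `V′₁(A)` with the GAUGE FIELD `A′` ITSELF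
# AS THE DATUM ((3.35) = unit-scale C² letters, CONSUMED), every U ≡ 1 input — forward and backward — a tree theorem

Cell `pub-ymgap`, seat `pub-ymgap-dag-n15-c` (generation g3; R134 ACCELERATION SEAT, strategy s1; HUMAN RULING D-0062; chair R424 venue; `bears_on: R4∕N15`).
Filed `--supports stmt-QuantumFields-19908 --as helper` (K3′; helper).  THEOREMS ONLY; imports BY NAME, nothing in the tree modified: this seat's
`…N15BackgroundV1GaugeByName` (**`ne2PlusOperator_v1G`**; through it `…N15BackgroundV1Gauge`: `bshiftEquiv`, `v1GVecInstance`, `v1GVecFamily4`), `…N15VectorPieceV1`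
(`uniform_layer_v1M`), n15-a part 8 `…N15DefectKernelHk163` (`pr_bpt`, `corner_le_and_steps`), n15-b `…N15KingTorusLine` (`site_add_unitVec_of_lt`),
`King1986.Torus.site_eq_bpt`, b05 `B5Blocks16.bpt_bijective`.

CONTENTS.  `norm_sub_le_of_walk` (generic monotone walk on an offset box: single-step bound `b` ⇒ `S` steps cost `S·b`; pattern of n15-a's `norm_gker_walk_le`),
`bpt_step` (one offset step inside a block is one lattice step), **`fibre_conn_kingPrV`** (an `E`-valued function on the fine bonds changing by `≤ b` per unit bond
shift oscillates by `≤ 2(d+1)(L^m − 1)·b` on every fibre of `kingPrV`), `bshiftEquiv_comm`; **`ne2PlusOperator_vectorPiece_v1G`**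
(`NE2PlusOperator c₃₅ (v1GVecInstance 𝔄 ι L hL) (v1GVecFamily4 𝔄 ι e L hL)`, `d + 1 ≥ 2`, `L ≥ 1`, every `c₃₅ > 0`; `C_πη′ = 2(d+1)(L^m−1)L^{−k}L^{−m} ≤ 2(d+1)θ_j`),
`_dim4`, `ne2ZeroOperator_vectorPiece_v1G` (`_dim4`; the trivial gauge field satisfies the C² letters).

HONEST FRAMING ∕ LIMITS.  A knit plus one lattice-geometric lemma; the C² letters are OUR unit-scale reading of the printed C² pair (3.35) ∧ (3.36); transport = fibrewise mean
(linearised (C3)), coarse triple = mean of the fine triple; `V′₂`, `F′_{1,k}` NOT included; LINEAR (U = 1) vector piece; NOT NODE 00's carriers.  NE2⁺ NOT PRINTED;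
count-neutral (typed 28∕28 · discharged unchanged); NOT a discharge of N15; one finite T⁴ at fixed ε — NOT infinite volume, NOT OS on ℝ⁴, NOT a mass gap, NOT Clay.
-/

noncomputable section

open scoped BigOperators
open Finset

/-! ## §2 The realised family: King's bond pairing has step-connected fibres; the knit at the vector piece ⊗ 1_𝔤 -/

namespace Summit.QuantumFields.YangMills.BalabanUVNodes.N15.VectorPiece

open Literature.MathematicalPhysics.QuantumFieldTheory.Balaban1983to89
open Literature.MathematicalPhysics.QuantumFieldTheory.Balaban1983to89.B11SectG (BlockNorm HasMaj RowSum)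
open Literature.MathematicalPhysics.QuantumFieldTheory.Balaban1983to89.B6RandomWalk (Triangle254)
open Literature.MathematicalPhysics.QuantumFieldTheory.Balaban1983to89.T4EtaRate (PairedInstance NE2PlusOperator NE2ZeroOperator ne2Zero_of_ne2Plus)
open Literature.MathematicalPhysics.QuantumFieldTheory.Balaban1983to89.T4EtaRateDefect (idef rateWeight)
open Literature.MathematicalPhysics.QuantumFieldTheory.Balaban1983to89.T4EtaRateCoeffDefect (pull)
open Literature.MathematicalPhysics.QuantumFieldTheory.Balaban1983to89.B5Prop11Plancherel (Tor fine unitVec)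
open Literature.MathematicalPhysics.QuantumFieldTheory.Balaban1983to89.B5Block118 (bpt)
open Literature.MathematicalPhysics.QuantumFieldTheory.Balaban1983to89.B5Blocks16 (bpt_bijective)
open Literature.MathematicalPhysics.QuantumFieldTheory.Balaban1983to89.B6UnitTorusCarrier (unitTorusGeo unitTorusGeo_len triangle254_unitTorusGeo
  rowSum_unitTorusGeo)
open Literature.MathematicalPhysics.QuantumFieldTheory.King1986.Torus (tdistT tdistT_nonneg site site_eq_bpt)
open Summit.QuantumFields.YangMills.BalabanUVNodes.N15.KingTorusLine (site_add_unitVec_of_lt)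
open Summit.QuantumFields.YangMills.BalabanUVNodes.N15.MatrixSpecies (liftMap liftBlk)
open Summit.QuantumFields.YangMills.BalabanUVNodes.N15.DefectKernel (pr_bpt corner_le_and_steps)
open Summit.QuantumFields.YangMills.BalabanUVNodes.N15.BackgroundLayer (ne2PlusOperator_v1G)

variable {d : ℕ}

section Walk

variable {E : Type} [SeminormedAddCommGroup E] {N : ℕ}

/-- **THE MONOTONE WALK**: if `g` on the offset box `[0, N)^{d+1}` changes by at most `b` under every single coordinate step, then for `c ≤ c′` with
`S = Σ_ν (c′_ν − c_ν)` steps, `‖g c′ − g c‖ ≤ S·b` (induction on `S`; pattern of n15-a's `norm_gker_walk_le`). [folklore] -/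
theorem norm_sub_le_of_walk (g : (Fin (d + 1) → Fin N) → E) {b : ℝ}
    (hstep : ∀ (κ : Fin (d + 1)) (c c' : Fin (d + 1) → Fin N), (c' κ : ℕ) = c κ + 1 → (∀ ν, ν ≠ κ → c' ν = c ν) → ‖g c' - g c‖ ≤ b) :
    ∀ (S : ℕ) (c c' : Fin (d + 1) → Fin N), (∀ ν, (c ν : ℕ) ≤ c' ν) → ∑ ν, ((c' ν : ℕ) - c ν) = S → ‖g c' - g c‖ ≤ S * b := by
  intro S
  induction S with
  | zero =>
    intro c c' hle hS
    have hcc : c = c' := by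
      funext ν
      have hν : (c' ν : ℕ) - c ν = 0 := (Finset.sum_eq_zero_iff.mp hS) ν (Finset.mem_univ ν)
      exact Fin.ext (le_antisymm (hle ν) (Nat.sub_eq_zero_iff_le.mp hν))
    subst hcc
    simp
  | succ S ih =>
    intro c c' hle hS
    obtain ⟨κ, hκ⟩ : ∃ κ, (c κ : ℕ) < c' κ := by
      by_contra h
      push Not at h
      have h0 : ∑ ν, ((c' ν : ℕ) - c ν) = 0 := Finset.sum_eq_zero fun ν _ => Nat.sub_eq_zero_of_le (h ν)
      omega
    let cs : Fin (d + 1) → Fin N := fun ν => if h : ν = κ then ⟨c κ + 1, lt_of_le_of_lt (Nat.succ_le_of_lt hκ) (c' κ).isLt⟩ else c ν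
    have h₀ : (cs κ : ℕ) = c κ + 1 := by simp [cs]
    have h₁ : ∀ ν, ν ≠ κ → cs ν = c ν := fun ν h => by simp [cs, h]
    have hle₁ : ∀ ν, (c ν : ℕ) ≤ cs ν := fun ν => by
      by_cases h : ν = κ
      · subst h; rw [h₀]; exact Nat.le_succ _
      · rw [h₁ ν h]
    have hle₂ : ∀ ν, (cs ν : ℕ) ≤ c' ν := fun ν => by
      by_cases h : ν = κ
      · subst h; rw [h₀]; exact Nat.succ_le_of_lt hκ
      · rw [h₁ ν h]; exact hle ν
    have hone : ∑ ν, ((cs ν : ℕ) - c ν) = 1 := by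
      rw [Finset.sum_eq_single κ (fun ν _ hν => by rw [h₁ ν hν, Nat.sub_self]) (fun h => absurd (Finset.mem_univ _) h), h₀, Nat.add_sub_cancel_left]
    have hS' : ∑ ν, ((c' ν : ℕ) - cs ν) = S := by
      have hsplit : ∑ ν, ((c' ν : ℕ) - c ν) = ∑ ν, ((c' ν : ℕ) - cs ν) + ∑ ν, ((cs ν : ℕ) - c ν) := by
        rw [← Finset.sum_add_distrib]
        exact Finset.sum_congr rfl fun ν _ => by have := hle₁ ν; have := hle₂ ν; omega
      rw [hsplit, hone] at hS
      omega
    calc ‖g c' - g c‖ = ‖(g c' - g cs) + (g cs - g c)‖ := by rw [sub_add_sub_cancel]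
      _ ≤ ‖g c' - g cs‖ + ‖g cs - g c‖ := norm_add_le _ _
      _ ≤ S * b + b := add_le_add (ih cs c' hle₂ hS') (hstep κ c cs h₀ h₁)
      _ = ((S + 1 : ℕ) : ℝ) * b := by push_cast; ring

end Walk

section Fibres

variable (L k m : ℕ) [NeZero L] (M : Fin (d + 1) → ℕ) [∀ μ, NeZero (M μ)]

/-- One offset step inside a block is one lattice step: `bpt y c′ = bpt y c + e_κ` when `c′ = c + e_κ` below the face. [folklore] -/
theorem bpt_step {n : ℕ} [NeZero n] (y : Tor M) (κ : Fin (d + 1)) (c c' : Fin (d + 1) → Fin n) (h₀ : (c' κ : ℕ) = c κ + 1)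
    (h₁ : ∀ ν, ν ≠ κ → c' ν = c ν) : bpt n M y c' = bpt n M y c + unitVec (fine n M) κ := by
  have hlt : (c κ : ℕ) + 1 < n := by rw [← h₀]; exact (c' κ).isLt
  have hc' : c' = Function.update c κ ⟨(c κ : ℕ) + 1, hlt⟩ := by
    funext ν
    by_cases h : ν = κ
    · subst h; rw [Function.update_self]; exact Fin.ext h₀
    · rw [Function.update_of_ne h, h₁ ν h]
  rw [hc', ← site_eq_bpt, ← site_eq_bpt]
  exact (site_add_unitVec_of_lt n M κ y c hlt).symm

/-- **KING's BOND PAIRING HAS STEP-CONNECTED FIBRES**: if an `E`-valued function on the fine bonds changes by at most `b` under every unit bond shift, then on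
every fibre of `kingPrV` (fine bonds over one coarse bond: a box of side `L^m`, same direction) it oscillates by at most `2(d+1)(L^m − 1)·b` — two monotone walks from
the block corner (`corner_le_and_steps`, `norm_sub_le_of_walk`). [cite: King1986, p.664 (pairing convention «x′ ∈ B^n(x)»: the fibres)] -/
theorem fibre_conn_kingPrV {E : Type} [SeminormedAddCommGroup E] (f : Tor (fine (L ^ m * L ^ k) M) × Fin (d + 1) → E) (b : ℝ)
    (hstep : ∀ κ i, ‖f (bshiftEquiv M (L ^ m * L ^ k) κ i) - f i‖ ≤ b) :
    ∀ i₁ i₂, kingPrV L k m M i₁ = kingPrV L k m M i₂ → ‖f i₁ - f i₂‖ ≤ (2 * ((d + 1) * (L ^ m - 1)) : ℕ) * b := by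
  intro i₁ i₂ hpr
  have hb : 0 ≤ b := (norm_nonneg _).trans (hstep 0 i₁)
  obtain ⟨⟨y₁, a₁⟩, hx₁⟩ := (bpt_bijective (L ^ m * L ^ k) M).2 i₁.1
  obtain ⟨⟨y₂, a₂⟩, hx₂⟩ := (bpt_bijective (L ^ m * L ^ k) M).2 i₂.1
  simp only at hx₁ hx₂
  rw [kingPrV_eq, kingPrV_eq, Prod.mk.injEq] at hpr
  obtain ⟨hpr₁, hdir⟩ := hpr
  -- the offsets over the paired coarse point
  let ah₁ : Fin (d + 1) → Fin (L ^ k) := fun ν => ⟨(a₁ ν : ℕ) / L ^ m, Nat.div_lt_of_lt_mul (a₁ ν).isLt⟩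
  let ah₂ : Fin (d + 1) → Fin (L ^ k) := fun ν => ⟨(a₂ ν : ℕ) / L ^ m, Nat.div_lt_of_lt_mul (a₂ ν).isLt⟩
  have hov₁ : ∀ ν, (a₁ ν : ℕ) / L ^ m = (ah₁ ν : ℕ) := fun ν => rfl
  have hov₂ : ∀ ν, (a₂ ν : ℕ) / L ^ m = (ah₂ ν : ℕ) := fun ν => rfl
  have hp₁ := pr_bpt (L ^ m) (L ^ k) M (kingPr L k m M) (kingPr_val L k m M) y₁ a₁ ah₁ hov₁
  have hp₂ := pr_bpt (L ^ m) (L ^ k) M (kingPr L k m M) (kingPr_val L k m M) y₂ a₂ ah₂ hov₂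
  rw [← hx₁, ← hx₂, hp₁, hp₂] at hpr₁
  obtain ⟨hy, hah⟩ := Prod.mk.inj ((bpt_bijective (L ^ k) M).1 hpr₁)
  -- the function along the block of `y₁`, direction `i₁.2`, and its per-step bound
  let g : (Fin (d + 1) → Fin (L ^ m * L ^ k)) → E := fun c => f (bpt (L ^ m * L ^ k) M y₁ c, i₁.2)
  have hg : ∀ (κ : Fin (d + 1)) (c c' : Fin (d + 1) → Fin (L ^ m * L ^ k)), (c' κ : ℕ) = c κ + 1 → (∀ ν, ν ≠ κ → c' ν = c ν) →
      ‖g c' - g c‖ ≤ b := fun κ c c' h₀ h₁ => by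
    show ‖f (bpt (L ^ m * L ^ k) M y₁ c', i₁.2) - f (bpt (L ^ m * L ^ k) M y₁ c, i₁.2)‖ ≤ b
    rw [bpt_step M y₁ κ c c' h₀ h₁]
    exact hstep κ (bpt (L ^ m * L ^ k) M y₁ c, i₁.2)
  -- the corner and the two walks
  obtain ⟨hc₁, hS₁⟩ := corner_le_and_steps (L ^ m) (L ^ k) a₁ ah₁ hov₁
  obtain ⟨hc₂, hS₂⟩ := corner_le_and_steps (L ^ m) (L ^ k) a₂ ah₂ hov₂
  let c₀ : Fin (d + 1) → Fin (L ^ m * L ^ k) := fun ν => ⟨L ^ m * (ah₁ ν : ℕ), lt_of_le_of_lt (hc₁ ν) (a₁ ν).isLt⟩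
  have hah' : ∀ ν, (ah₂ ν : ℕ) = ah₁ ν := fun ν => (congrArg (fun t : Fin (L ^ k) => (t : ℕ)) (congrFun hah ν)).symm
  have hw₁ := norm_sub_le_of_walk g hg _ c₀ a₁ (fun ν => hc₁ ν) rfl
  have hw₂ := norm_sub_le_of_walk g hg _ c₀ a₂ (fun ν => by show L ^ m * (ah₁ ν : ℕ) ≤ a₂ ν; rw [← hah' ν]; exact hc₂ ν) rfl
  have hS₂' : ∑ ν, ((a₂ ν : ℕ) - (c₀ ν : ℕ)) ≤ (d + 1) * (L ^ m - 1) := by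
    have : ∑ ν, ((a₂ ν : ℕ) - (c₀ ν : ℕ)) = ∑ ν, ((a₂ ν : ℕ) - L ^ m * (ah₂ ν : ℕ)) := Finset.sum_congr rfl fun ν _ => by
      show (a₂ ν : ℕ) - L ^ m * (ah₁ ν : ℕ) = _; rw [hah' ν]
    rw [this]; exact hS₂
  have hS₁' : ∑ ν, ((a₁ ν : ℕ) - (c₀ ν : ℕ)) ≤ (d + 1) * (L ^ m - 1) := hS₁
  have hi₁ : i₁ = (bpt (L ^ m * L ^ k) M y₁ a₁, i₁.2) := Prod.ext hx₁.symm rfl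
  have hi₂ : i₂ = (bpt (L ^ m * L ^ k) M y₁ a₂, i₁.2) := Prod.ext (by rw [hy]; exact hx₂.symm) hdir.symm
  have e₁ : f i₁ = g a₁ := by rw [hi₁]
  have e₂ : f i₂ = g a₂ := by rw [hi₂]
  rw [e₁, e₂]
  calc ‖g a₁ - g a₂‖ = ‖(g a₁ - g c₀) - (g a₂ - g c₀)‖ := by rw [sub_sub_sub_cancel_right]
    _ ≤ ‖g a₁ - g c₀‖ + ‖g a₂ - g c₀‖ := norm_sub_le _ _
    _ ≤ (∑ ν, ((a₁ ν : ℕ) - (c₀ ν : ℕ)) : ℕ) * b + (∑ ν, ((a₂ ν : ℕ) - (c₀ ν : ℕ)) : ℕ) * b := add_le_add hw₁ hw₂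
    _ ≤ ((d + 1) * (L ^ m - 1) : ℕ) * b + ((d + 1) * (L ^ m - 1) : ℕ) * b :=
        add_le_add (mul_le_mul_of_nonneg_right (by exact_mod_cast hS₁') hb) (mul_le_mul_of_nonneg_right (by exact_mod_cast hS₂') hb)
    _ = (2 * ((d + 1) * (L ^ m - 1)) : ℕ) * b := by push_cast; ring

omit [NeZero L] [∀ μ, NeZero (M μ)] in
/-- The bond shifts commute: `(x + e_κ) − e_μ = (x − e_μ) + e_κ`. [folklore] -/
theorem bshiftEquiv_comm (n : ℕ) (μ κ : Fin (d + 1)) (i : Tor (fine n M) × Fin (d + 1)) :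
    (bshiftEquiv M n μ).symm (bshiftEquiv M n κ i) = bshiftEquiv M n κ ((bshiftEquiv M n μ).symm i) := by
  ext <;> simp [sub_add_eq_add_sub]

end Fibres

section Knit

variable {𝔄 : Type} [NormedRing 𝔄] [NormedAlgebra ℝ 𝔄] [CompleteSpace 𝔄] {ι : Type} [Fintype ι] [DecidableEq ι] (e : 𝔄 ≃L[ℝ] (ι → ℝ)) {L : ℕ} [NeZero L]

/-- **NE2⁺, OPERATOR LAYER — `T4EtaRate.NE2PlusOperator` BY NAME FOR THE U = 1 VECTOR SINGLE-SCALE PIECE ⊗ 1_𝔤 DRESSED BY THE PRINT's `V′₁(A)` WITH THE GAUGE FIELD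
`A′` ITSELF AS THE DATUM**: the realised family over the C²-letter gauge carriers (configurations `A′ : Fin (d+1) → X′ → 𝔄`; (3.35) = sup, first and second
lattice differences at the unit scale, CONSUMED to produce the (3.35) letter pair of the derived triple `(A′, A′(· − e_μ), ∇′*A′)`), size guard LIVE
(`v1GVecInstance_gf_M`, unbounded `M`), all four entries CONSTRUCTED over the forward∕backward stack, and EVERY U ≡ 1 input — the twelve families of
`uniform_layer_v1M`, forward AND backward — a landed theorem; King's bond pairing step-connected with `C_π = 2(d+1)(L^m − 1)`, `C_πη′ ≤ 2(d+1)η ≤ 2(d+1)θ_j`.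
[cite: Balaban1985BackgroundPropagators, Thm 3.1 p.397 (quantifier template), (3.35)–(3.36) p.396, (3.42) p.397, (3.44) p.398, (3.50)–(3.52) p.400, (3.63)–(3.65) pp.402–403 (shapes, mechanism); King1986, (4.42)–(4.43) p.675, p.664] -/
theorem ne2PlusOperator_vectorPiece_v1G (hd : 1 ≤ d) (hL : 1 ≤ L) (c35 : ℝ) (hc35 : 0 < c35) :
    NE2PlusOperator c35 (v1GVecInstance (d := d) 𝔄 ι L hL) (v1GVecFamily4 (d := d) 𝔄 ι e L hL) := by
  obtain ⟨β, δ, m₀, hβ, hδ, hm₀, H⟩ := uniform_layer_v1M (d := d) (ι := ι) (L := L) hd hL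
  have hL0 : L ≠ 0 := by omega
  have hLr : (0 : ℝ) < (L : ℝ) := by exact_mod_cast (show 0 < L by omega)
  have hL1 : (1 : ℝ) ≤ (L : ℝ) := by exact_mod_cast hL
  have hσ : 0 < δ / 2 := half_pos hδ
  have hd1 : (0 : ℝ) ≤ 2 * ((d : ℝ) + 1) := by positivity
  -- `C_π(j)·η′_j = 2(d+1)(L^m − 1)·L^{−k}L^{−m} ≤ 2(d+1)·L^{−k} ≤ 2(d+1)·θ_j`
  have hCθ : ∀ j : VecIndexS d L, ((2 * ((d + 1) * (L ^ j.m - 1)) : ℕ) : ℝ) *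
      ((unitTorusGeoS L j.k j.Mn j.Msz).eta * ((unitTorusGeoS L j.k j.Mn j.Msz).L ^ j.m)⁻¹) ≤ 2 * ((d : ℝ) + 1) * thetaV L j := by
    intro j
    have hLm : (0 : ℝ) < (L : ℝ) ^ j.m := pow_pos hLr _
    have hLk : (0 : ℝ) < (L : ℝ) ^ j.k := pow_pos hLr _
    have hθ : ((L : ℝ) ^ j.k)⁻¹ ≤ thetaV L j := inv_pow_le_rpow hL j.k (by norm_num)
    have hsub : (((L ^ j.m - 1 : ℕ)) : ℝ) ≤ (L : ℝ) ^ j.m := by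
      have h1 : 1 ≤ L ^ j.m := Nat.one_le_pow _ _ (by omega)
      rw [Nat.cast_sub h1]; push_cast; linarith
    show ((2 * ((d + 1) * (L ^ j.m - 1)) : ℕ) : ℝ) * (((L : ℝ) ^ j.k)⁻¹ * ((L : ℝ) ^ j.m)⁻¹) ≤ 2 * ((d : ℝ) + 1) * thetaV L j
    have hcast : ((2 * ((d + 1) * (L ^ j.m - 1)) : ℕ) : ℝ) = 2 * ((d : ℝ) + 1) * (((L ^ j.m - 1 : ℕ)) : ℝ) := by push_cast; ring
    rw [hcast]
    calc 2 * ((d : ℝ) + 1) * (((L ^ j.m - 1 : ℕ)) : ℝ) * (((L : ℝ) ^ j.k)⁻¹ * ((L : ℝ) ^ j.m)⁻¹)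
        ≤ 2 * ((d : ℝ) + 1) * (L : ℝ) ^ j.m * (((L : ℝ) ^ j.k)⁻¹ * ((L : ℝ) ^ j.m)⁻¹) :=
          mul_le_mul_of_nonneg_right (mul_le_mul_of_nonneg_left hsub hd1) (by positivity)
      _ = 2 * ((d : ℝ) + 1) * ((L : ℝ) ^ j.k)⁻¹ := by field_simp
      _ ≤ 2 * ((d : ℝ) + 1) * thetaV L j := mul_le_mul_of_nonneg_left hθ hd1
  exact ne2PlusOperator_v1G e (I := VecIndexS d L) (J := Fin (d + 1)) (fun j => unitTorusGeoS L j.k j.Mn j.Msz)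
    (fun j => Tor (fine (L ^ j.k) j.Mn) × Fin (d + 1)) (fun j => Tor (fine (L ^ j.m * L ^ j.k) j.Mn) × Fin (d + 1))
    (fun j => blkFine L j.k j.Mn) (fun j => kingPrV L j.k j.m j.Mn) (fun j κ => bshiftEquiv j.Mn (L ^ j.k) κ) (fun j κ => bshiftEquiv j.Mn (L ^ j.m * L ^ j.k) κ)
    (fun j => j.m) (fun j => unitTorusGeoS_L_ne_zero L hL j) (thetaV L) (fun j => ((2 * ((d + 1) * (L ^ j.m - 1)) : ℕ) : ℝ))
    (fun j => Sum.inl j.ν)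
    (fun j => tensorId ι (pieceG L j.Mn (L ^ j.k) j.k (rweight (d := d) L j.k)))
    (fun j => tensorId ι (pieceS L j.Mn (L ^ j.k) j.k (rweight (d := d) L j.k) j.ν))
    (fun j => tensorId ι (pieceD3 L j.Mn (L ^ j.k) j.k (rweight (d := d) L j.k)))
    (fun j μ => tensorId ι (dPieces L j.Mn (L ^ j.k) j.k (rweight (d := d) L j.k) μ))
    (fun j μ => tensorId ι (mPieces L j.Mn (L ^ j.k) j.k (rweight (d := d) L j.k) j.ν μ))
    (fun j => tensorId ι (pieceG L j.Mn (L ^ j.m * L ^ j.k) (j.k + j.m) (rweight (d := d) L j.k / ((L : ℝ) ^ j.m) ^ (d + 1))))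
    (fun j => tensorId ι (pieceS L j.Mn (L ^ j.m * L ^ j.k) (j.k + j.m) (rweight (d := d) L j.k / ((L : ℝ) ^ j.m) ^ (d + 1)) j.ν))
    (fun j => tensorId ι (pieceD3 L j.Mn (L ^ j.m * L ^ j.k) (j.k + j.m) (rweight (d := d) L j.k / ((L : ℝ) ^ j.m) ^ (d + 1))))
    (fun j μ => tensorId ι (dPieces L j.Mn (L ^ j.m * L ^ j.k) (j.k + j.m) (rweight (d := d) L j.k / ((L : ℝ) ^ j.m) ^ (d + 1)) μ))
    (fun j μ => tensorId ι (mPieces L j.Mn (L ^ j.m * L ^ j.k) (j.k + j.m) (rweight (d := d) L j.k / ((L : ℝ) ^ j.m) ^ (d + 1)) j.ν μ))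
    c35 hc35 (fun j => triangle254_unitTorusGeo L j.k j.Mn) (fun j a b => tdistT_nonneg _ _ _) hσ.le
    (B4Sect5Proof.latticeConst_nonneg (d + 1) hσ.le) (fun j => rowSum_unitTorusGeo L j.k j.Mn hσ)
    (fun j => inv_pos.mpr (pow_pos hLr _)) (fun j => inv_le_one_of_one_le₀ (one_le_pow₀ hL1)) (fun j => inv_pow_le_rpow hL j.k (by norm_num))
    (fun j => hL1) (fun j y => (unitTorusGeo_len L j.k j.Mn hL0 y).symm.le)
    (by linarith) hβ.le hm₀.le (by norm_num : (0 : ℝ) < 1 / 4) (fun j y => le_rfl)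
    (fun j μ κ x => bshiftEquiv_comm j.Mn (L ^ j.m * L ^ j.k) μ κ x) (fun j => Nat.cast_nonneg _)
    (fun j f b hf => fibre_conn_kingPrV L j.k j.m j.Mn f b hf) hd1 hCθ
    (fun j => (H j).1) (fun j => (H j).2.1) (fun j => (H j).2.2.1) (fun j => (H j).2.2.2.1) (fun j => (H j).2.2.2.2.1)
    (fun j => (H j).2.2.2.2.2.1) (fun j => (H j).2.2.2.2.2.2.1) (fun j => (H j).2.2.2.2.2.2.2.1) (fun j => (H j).2.2.2.2.2.2.2.2.1)
    (fun j => (H j).2.2.2.2.2.2.2.2.2.1) (fun j => (H j).2.2.2.2.2.2.2.2.2.2.1) (fun j => (H j).2.2.2.2.2.2.2.2.2.2.2)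

/-- The four-dimensional instance (`d + 1 = 4`). [cite: Balaban1985BackgroundPropagators, Thm 3.1 p.397 (quantifier template)] -/
theorem ne2PlusOperator_vectorPiece_v1G_dim4 (hL : 1 ≤ L) (c35 : ℝ) (hc35 : 0 < c35) :
    NE2PlusOperator c35 (v1GVecInstance (d := 3) 𝔄 ι L hL) (v1GVecFamily4 (d := 3) 𝔄 ι e L hL) :=
  ne2PlusOperator_vectorPiece_v1G (d := 3) e (by norm_num) hL c35 hc35

/-- **NE2⁰ FOR THE SAME FAMILY — `T4EtaRate.NE2ZeroOperator` BY NAME**: the trivial gauge field `A′ = 0` (the carrier's `one`) satisfies the C² letters for every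
`α₀ > 0` (`M ≥ 1`), so `T4EtaRate.ne2Zero_of_ne2Plus` applies at `c₃₅ = 1`. [cite: King1986, Props. 3.8–3.9 (3.71)–(3.75) pp.664–665 (A = 0 model); Balaban1985BackgroundPropagators, Thm 3.1 p.397 (quantifier template)] -/
theorem ne2ZeroOperator_vectorPiece_v1G (hd : 1 ≤ d) (hL : 1 ≤ L) :
    NE2ZeroOperator (v1GVecInstance (d := d) 𝔄 ι L hL) (v1GVecFamily4 (d := d) 𝔄 ι e L hL) := by
  refine ne2Zero_of_ne2Plus (c35 := 1) (fun j α₀ hα₀ => ?_) (ne2PlusOperator_vectorPiece_v1G (d := d) e hd hL 1 one_pos)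
  have hM : 0 ≤ (1 : ℝ) * j.Msz * α₀ := by
    have h1 : (0 : ℝ) ≤ j.Msz := zero_le_one.trans j.one_le_Msz
    positivity
  have hLr : (0 : ℝ) ≤ (L : ℝ) := Nat.cast_nonneg L
  have hη : 0 ≤ ((L : ℝ) ^ j.k)⁻¹ * ((L : ℝ) ^ j.m)⁻¹ := mul_nonneg (inv_nonneg.2 (pow_nonneg hLr _)) (inv_nonneg.2 (pow_nonneg hLr _))
  refine ⟨fun μ x' => ?_, fun μ κ x' => ?_, fun μ κ x' => ?_⟩
  · show ‖(0 : 𝔄)‖ ≤ 1 * j.Msz * α₀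
    rw [norm_zero]; exact hM
  · show ‖(0 : 𝔄) - 0‖ ≤ 1 * j.Msz * α₀ * (((L : ℝ) ^ j.k)⁻¹ * ((L : ℝ) ^ j.m)⁻¹)
    rw [sub_zero, norm_zero]; exact mul_nonneg hM hη
  · show ‖(0 : 𝔄) - 0 - (0 - 0)‖ ≤ 1 * j.Msz * α₀ * (((L : ℝ) ^ j.k)⁻¹ * ((L : ℝ) ^ j.m)⁻¹) * (((L : ℝ) ^ j.k)⁻¹ * ((L : ℝ) ^ j.m)⁻¹)
    rw [show (0 : 𝔄) - 0 - (0 - 0) = 0 by simp, norm_zero]; exact mul_nonneg (mul_nonneg hM hη) hη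

/-- The four-dimensional instance of the NE2⁰ corollary. [cite: King1986, Props. 3.8–3.9 (3.71)–(3.75) pp.664–665 (A = 0 model)] -/
theorem ne2ZeroOperator_vectorPiece_v1G_dim4 (hL : 1 ≤ L) :
    NE2ZeroOperator (v1GVecInstance (d := 3) 𝔄 ι L hL) (v1GVecFamily4 (d := 3) 𝔄 ι e L hL) :=
  ne2ZeroOperator_vectorPiece_v1G (d := 3) e (by norm_num) hL

end Knit

end Summit.QuantumFields.YangMills.BalabanUVNodes.N15.VectorPiece

end
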